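import Mathlib.FieldTheory.RatFunc.AsPolynomial
import Literature.NumberTheory.DiophantineGeometry.FunctionFieldTotallyRamifiedStep
import Literature.NumberTheory.DiophantineGeometry.GarciaStichtenothLocal
import Literature.NumberTheory.DiophantineGeometry.RatFuncPlaces
import HarnessLib

/-!
# The Garcia–Stichtenoth tower: construction of the levels (Stichtenoth Def. 7.4.1, Lemma 7.4.3)

Topic: `Literature/NumberTheory/DiophantineGeometry` (sub-namespace `GSTower` naming the object).
For a field `K` and an integer `q ≥ 2` we construct the tower of function fields over `K`

  `G₀ = K(x₀)`,  `G_{N+1} = G_N(x_{N+1})`,  `x_{N+1}^q - x_{N+1} = x_N^q / (1 - x_N^{q-1})`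

of [Stichtenoth 2009, Def. 7.4.1, (7.14)–(7.15)] (= [Garcia–Stichtenoth 1996, (3.1)] up to the
substitution of Remark 7.4.2; for `q = ℓ` a power of `p = char K` and `K = 𝔽_{ℓ²}` this is the
optimal wild tower of Thm. 7.4.7). Each level is built as `AdjoinRoot (T^q - T - u(x_N))` over the
previous one, the polynomial being irreducible because `u(x_N) = x_N^q/(1 - x_N^{q-1})` has a simple
pole at the place `P_∞^{(N)}` (`FunctionFieldArtinSchreierIrreducible`), and **Lemma 7.4.3** is proved
along the construction: `[G_{N+1} : G_N] = q`, the pole `P_∞^{(0)}` of `x₀` is totally ramified in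
`G_N/G₀` — the level `N` carries a rational place `P_∞^{(N)}` with `v(x_i) = -q^{N-i}` for
`i ≤ N` (`FunctionFieldTotallyRamifiedStep`) — and `[G_N : K(x₀)] = q^N`.

## Main definitions

* `GSTower.Level K q`: a level of the tower (a function field
  over `K` with generators `x 0, …, x N`, the relations, the place `P_∞` and its data,
  `[G : K(x₀)] = q^N`);
* `GSTower.Level.poly`, `GSTower.Level.Next = AdjoinRoot poly`, `GSTower.Level.next`: the next
  level; `GSTower.base` (`K(x₀)`), `GSTower.level K q N` (the `N`-th level).

No genus or splitting statement is made here (see the sibling files); nothing is a named fact.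

## References

* H. Stichtenoth, *Algebraic Function Fields and Codes*, 2nd ed., GTM 254, Springer 2009:
  Def. 7.4.1, Remark 7.4.2, Lemma 7.4.3. [Stichtenoth2009]
* A. Garcia, H. Stichtenoth, *On the asymptotic behaviour of some towers of function fields over
  finite fields*, J. Number Theory 61 (1996) 248–273, §3, (3.1), Lemma 3.3. [GarciaStichtenoth1996]
-/

noncomputable section

open scoped Classical Polynomial IntermediateField
open Polynomial

namespace Literature.NumberTheory.DiophantineGeometry

open AlgFunctionField

namespace GSTower

universe u

/-! ### Levels of the tower -/

variable (K : Type) [Field K] (q : ℕ)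

/-- **A level of the Garcia–Stichtenoth tower over `K`**: a function field `G/K` with generators
`x 0, …, x N` satisfying `x (i+1)^q - x (i+1) = u(x i)`, together with the rational place `P_∞`
(the pole of `x 0`) at which `v(x i) = -q^{N-i}`, and the degree `[G : K(x 0)] = q^N`
(Stichtenoth Def. 7.4.1 and Lemma 7.4.3). Values `x i` for `i > N` are irrelevant.
[cite: Stichtenoth2009, Def. 7.4.1 and Lemma 7.4.3] -/
structure Level where
  /-- The field `G_N`. -/
  carrier : Type
  [instField : Field carrier]
  [instAlgebra : Algebra K carrier]
  [instFunField : IsAlgFunctionField K carrier]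
  /-- The index `N` of the level. -/
  N : ℕ
  /-- The generators `x 0, …, x N` (junk beyond `N`). -/
  x : ℕ → carrier
  /-- The defining relations `x_{i+1}^q - x_{i+1} = x_i^q/(1 - x_i^{q-1})`. -/
  rel : ∀ i < N, x (i + 1) ^ q - x (i + 1) = u q (x i)
  /-- The place `P_∞^{(N)}`. -/
  Pinf : PlaceOver K carrier
  /-- `P_∞^{(N)}` is rational. -/
  isRational_Pinf : Pinf.IsRational
  /-- `v_{P_∞}(x_i) = -q^{N-i}` (total ramification of the pole of `x₀`). -/
  ord_Pinf : ∀ i ≤ N, Pinf.ord (x i) = -((q : ℤ) ^ (N - i))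
  /-- `[G_N : K(x₀)] = q^N`. -/
  finrank_eq : Module.finrank K⟮x 0⟯ carrier = q ^ N

attribute [instance] Level.instField Level.instAlgebra Level.instFunField

namespace Level

variable {K q} [hq : Fact (2 ≤ q)] (L : Level K q)

omit hq in
/-- `x_N` has a simple pole at `P_∞^{(N)}`. [cite: Stichtenoth2009, Lemma 7.4.3] -/
theorem ord_Pinf_x_N : L.Pinf.ord (L.x L.N) = -1 := by
  have := L.ord_Pinf L.N le_rfl
  rwa [Nat.sub_self, pow_zero] at this

/-- `u(x_N)` has a simple pole at `P_∞^{(N)}`. [cite: Stichtenoth2009, Lemma 7.4.3 (proof)] -/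
theorem ord_Pinf_u : L.Pinf.ord (u q (L.x L.N)) = -1 := by
  rw [(ord_u_of_ord_neg L.Pinf hq.out (by rw [L.ord_Pinf_x_N]; norm_num)).2, L.ord_Pinf_x_N]

/-- The polynomial `T^q - T - u(x_N)` defining the next level. [cite: Stichtenoth2009, Def. 7.4.1] -/
def poly : (L.carrier)[X] :=
  X ^ q - X - C (u q (L.x L.N))

/-- It is irreducible (`u(x_N)` has a simple pole at `P_∞^{(N)}`; Stichtenoth Lemma 7.4.3:
`[G_{i+1} : G_i] = ℓ`). [cite: Stichtenoth2009, Lemma 7.4.3] -/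
theorem irreducible_poly : Irreducible L.poly :=
  L.Pinf.irreducible_X_pow_sub_X_sub_C_of_ord_eq_neg_one L.ord_Pinf_u hq.out

/-- Registered as a `Fact` so that `AdjoinRoot L.poly` is a field. [folklore] -/
instance fact_irreducible_poly : Fact (Irreducible L.poly) := ⟨L.irreducible_poly⟩

/-- It is monic of degree `q`. [folklore] -/
theorem monic_poly : L.poly.Monic := monic_X_pow_sub_X_sub_C _ hq.out

/-- Its degree is `q`. [folklore] -/
theorem natDegree_poly : L.poly.natDegree = q := natDegree_X_pow_sub_X_sub_C _ hq.out

/-- **The next field `G_{N+1} = G_N[T]/(T^q - T - u(x_N))`.** [cite: Stichtenoth2009, Def. 7.4.1] -/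
abbrev Next : Type := AdjoinRoot L.poly

/-- `G_{N+1}` is finite over `G_N`. [folklore] -/
instance finiteDimensional_next : FiniteDimensional L.carrier L.Next :=
  (AdjoinRoot.powerBasis L.irreducible_poly.ne_zero).finite

/-- `[G_{N+1} : G_N] = q`. [cite: Stichtenoth2009, Lemma 7.4.3] -/
theorem finrank_next : Module.finrank L.carrier L.Next = q := by
  rw [(AdjoinRoot.powerBasis L.irreducible_poly.ne_zero).finrank, AdjoinRoot.powerBasis_dim,
    L.natDegree_poly]

/-- `G_{N+1}` is a function field over `K`. [folklore] -/
instance isAlgFunctionField_next : IsAlgFunctionField K L.Next :=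
  isAlgFunctionField_of_finiteDimensional (F := L.carrier)

omit hq in
/-- Constants of `K` in `G_{N+1}` come from `G_N`. [folklore] -/
theorem algebraMap_next (c : K) :
    algebraMap K L.Next c = algebraMap L.carrier L.Next (algebraMap K L.carrier c) :=
  IsScalarTower.algebraMap_apply K L.carrier L.Next c

/-- The defining relation of the new generator: `x_{N+1}^q - x_{N+1} = u(x_N)`.
[cite: Stichtenoth2009, Def. 7.4.1 (7.15)] -/
theorem root_pow_sub_root :
    AdjoinRoot.root L.poly ^ q - AdjoinRoot.root L.poly = algebraMap L.carrier L.Next (u q (L.x L.N)) := by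
  have h := AdjoinRoot.eval₂_root L.poly
  rw [poly, eval₂_sub, eval₂_sub, eval₂_X_pow, eval₂_X, eval₂_C, sub_eq_zero] at h
  exact h

/-- **`P_∞^{(N+1)}`**: a place of `G_{N+1}` above `P_∞^{(N)}` (unique, by total ramification).
[cite: Stichtenoth2009, Lemma 7.4.3] -/
def nextPinf : PlaceOver K L.Next :=
  (L.Pinf.exists_restrict_eq' (F' := L.Next)).choose

/-- `P_∞^{(N+1)}` lies above `P_∞^{(N)}`. [cite: Stichtenoth2009, Lemma 7.4.3] -/
theorem restrict_nextPinf : L.nextPinf.restrict (K := K) (F := L.carrier) = L.Pinf :=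
  (L.Pinf.exists_restrict_eq' (F' := L.Next)).choose_spec

/-- **Lemma 7.4.3 at the step `G_{N+1}/G_N`**: `v_{P_∞^{(N+1)}}(x_{N+1}) = -1`,
`e(P_∞^{(N+1)} | P_∞^{(N)}) = q`, `P_∞^{(N+1)}` is the only place above `P_∞^{(N)}` and is rational.
[cite: Stichtenoth2009, Lemma 7.4.3] -/
theorem nextPinf_spec :
    L.nextPinf.ord (AdjoinRoot.root L.poly) = -1 ∧
    L.nextPinf.ord (algebraMap L.carrier L.Next (L.Pinf.uniformizer : L.carrier)) = q ∧
    (∀ P'' : PlaceOver K L.Next, P''.restrict (K := K) (F := L.carrier) = L.Pinf → P'' = L.nextPinf) ∧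
    L.nextPinf.degree = 1 := by
  obtain ⟨h1, h2, -, h4, h5⟩ := PlaceOver.totallyRamified_of_pow_sub_eq L.restrict_nextPinf hq.out
    L.finrank_next.le L.root_pow_sub_root L.ord_Pinf_u
  exact ⟨h1, h2, h4, h5.trans L.isRational_Pinf⟩

/-- Orders of elements of `G_N` at `P_∞^{(N+1)}` are multiplied by `q`. [cite: Stichtenoth2009, Lemma 7.4.3] -/
theorem ord_nextPinf_algebraMap (z : L.carrier) :
    L.nextPinf.ord (algebraMap L.carrier L.Next z) = q * L.Pinf.ord z := by
  have h := L.nextPinf.ord_algebraMap_eq_mul (K := K) (F := L.carrier) z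
  rw [L.restrict_nextPinf, L.nextPinf_spec.2.1] at h
  exact h

/-- **The next level `G_{N+1}`** of the tower, with `x_{N+1}` the class of `T` and
`P_∞^{(N+1)}` the place above `P_∞^{(N)}` (reducible, so that `L.next.carrier` is seen to be
`L.Next = AdjoinRoot L.poly` by instance resolution). [cite: Stichtenoth2009, Def. 7.4.1 and Lemma 7.4.3] -/
@[reducible] def next : Level K q where
  carrier := L.Next
  N := L.N + 1
  x i := if i = L.N + 1 then AdjoinRoot.root L.poly else algebraMap L.carrier L.Next (L.x i)
  rel i hi := by
    rcases Nat.lt_succ_iff_lt_or_eq.1 hi with hi | rfl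
    · rw [if_neg (by omega), if_neg (by omega), ← map_u, ← map_pow, ← map_sub, L.rel i hi]
    · rw [if_pos rfl, if_neg (by omega), L.root_pow_sub_root, map_u]
  Pinf := L.nextPinf
  isRational_Pinf := L.nextPinf_spec.2.2.2
  ord_Pinf i hi := by
    rcases Nat.lt_succ_iff_lt_or_eq.1 (Nat.lt_succ_iff.2 hi) with hi | rfl
    · rw [if_neg (by omega), L.ord_nextPinf_algebraMap, L.ord_Pinf i (by omega),
        show L.N + 1 - i = (L.N - i) + 1 by omega, pow_succ]
      ring
    · rw [if_pos rfl, L.nextPinf_spec.1, Nat.sub_self, pow_zero]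
  finrank_eq := by
    haveI : FiniteDimensional K⟮L.x 0⟯ L.carrier := Module.finite_of_finrank_pos (by
      rw [L.finrank_eq]; exact pow_pos (by have := hq.out; omega) _)
    rw [if_neg (by omega), PlaceOver.finrank_adjoin_algebraMap_eq_mul, L.finrank_next, L.finrank_eq,
      pow_succ, mul_comm]

/-- The next level has index `N + 1`. [folklore] -/
@[simp] theorem next_N : L.next.N = L.N + 1 := rfl

/-- The old generators, read in `G_{N+1}`. [folklore] -/
theorem next_x_of_le {i : ℕ} (hi : i ≤ L.N) : L.next.x i = algebraMap L.carrier L.Next (L.x i) :=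
  if_neg (by omega)

/-- The new generator `x_{N+1}`. [folklore] -/
theorem next_x_succ : L.next.x (L.N + 1) = AdjoinRoot.root L.poly := if_pos rfl

/-- The place `P_∞^{(N+1)}` of the next level. [folklore] -/
theorem next_Pinf : L.next.Pinf = L.nextPinf := rfl

/-! ### Elementary properties of a level -/

/-- The generators `x_i`, `i ≤ N`, are non-zero (they have a pole at `P_∞`). [folklore] -/
theorem x_ne_zero {i : ℕ} (hi : i ≤ L.N) : L.x i ≠ 0 :=
  L.Pinf.ne_zero_of_ord_ne_zero (by rw [L.ord_Pinf i hi]; exact neg_ne_zero.2 (pow_ne_zero _ (by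
    have := hq.out; exact_mod_cast (by omega : q ≠ 0))))

/-- The generators `x_i`, `i ≤ N`, are transcendental over `K` (algebraic elements have no poles).
[folklore] -/
theorem transcendental_x {i : ℕ} (hi : i ≤ L.N) : Transcendental K (L.x i) := fun halg => by
  have h := L.Pinf.ord_eq_zero_of_isAlgebraic (L.x_ne_zero hi) halg
  rw [L.ord_Pinf i hi] at h
  exact absurd h (neg_ne_zero.2 (pow_ne_zero _ (by have := hq.out; exact_mod_cast (by omega : q ≠ 0))))

/-- Non-zero polynomials do not vanish at `x_i`. [folklore] -/
theorem aeval_x_ne_zero {i : ℕ} (hi : i ≤ L.N) {f : K[X]} (hf : f ≠ 0) : aeval (L.x i) f ≠ 0 :=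
  fun h => L.transcendental_x hi ⟨f, hf, h⟩

/-- **`P_∞^{(N)}` is the only pole of `x₀`** (Lemma 7.4.3: the pole of `x₀` is totally ramified;
here from `deg (1/x₀)₀ ≤ [G_N : K(x₀)] = q^N = -v_{P_∞}(x₀)`). [cite: Stichtenoth2009, Lemma 7.4.3] -/
theorem eq_Pinf_of_ord_neg {Q : PlaceOver K L.carrier} (hQ : Q.ord (L.x 0) < 0) : Q = L.Pinf := by
  by_contra hne
  have hq0 : (q : ℤ) ≠ 0 := by have := hq.out; exact_mod_cast (by omega : q ≠ 0)
  have h0 := L.ord_Pinf 0 (Nat.zero_le _)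
  rw [Nat.sub_zero] at h0
  have hx0 : L.x 0 ≠ 0 := L.x_ne_zero (Nat.zero_le _)
  have hinvP : L.Pinf.ord (L.x 0)⁻¹ = (q : ℤ) ^ L.N := by rw [L.Pinf.ord_inv hx0, h0, neg_neg]
  have htr : Transcendental K (L.x 0)⁻¹ := fun halg => by
    have h := L.Pinf.ord_eq_zero_of_isAlgebraic (inv_ne_zero hx0) halg
    rw [hinvP] at h
    exact pow_ne_zero _ hq0 h
  have hadj : K⟮(L.x 0)⁻¹⟯ = K⟮L.x 0⟯ := le_antisymm
    (IntermediateField.adjoin_simple_le_iff.2 (inv_mem (IntermediateField.mem_adjoin_simple_self K _)))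
    (IntermediateField.adjoin_simple_le_iff.2 (by
      have h := inv_mem (IntermediateField.mem_adjoin_simple_self K (L.x 0)⁻¹)
      rwa [inv_inv] at h))
  have hsum := sum_ord_mul_degree_le_finrank_int htr {Q, L.Pinf} (fun v hv => by
    simp only [Finset.mem_insert, Finset.mem_singleton] at hv
    rcases hv with rfl | rfl
    · rw [v.ord_inv hx0]; omega
    · rw [hinvP]; positivity)
  rw [Finset.sum_pair hne, hadj, L.finrank_eq, hinvP, L.isRational_Pinf, Q.ord_inv hx0] at hsum
  have hdeg : (1 : ℤ) ≤ Q.degree := by exact_mod_cast PlaceOver.degree_pos_holds Q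
  push_cast at hsum
  nlinarith

/-! ### Profiles of places (the data of Lemmas 7.4.5–7.4.6 / [GS96, Lemmas 3.3–3.5]) -/

/-- **Profile of a place in general position**: `Q` is a place of `G_N` at which `x₀` is finite
with residue `x₀(Q) ∉ 𝔽_q` (i.e. `x₀^q - x₀` is a unit). Content: all `x_i` are then finite with
`x_i(Q) ∉ 𝔽_q`, and `Q` is unramified over `K(x₀)`: some `p(x₀)`, `p ∈ K[T]`, is a local parameter
with `p'(x₀)` a unit ([GS96, Lemma 3.3 (iii)]; Stichtenoth Lemma 7.4.5: the ramification locus lies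
over `𝔽_ℓ ∪ {∞}`). [cite: Stichtenoth2009, Lemma 7.4.5] [cite: GarciaStichtenoth1996, Lemma 3.3] -/
structure GenericProfile (Q : PlaceOver K L.carrier) : Prop where
  /-- all `x_i` are finite at `Q` -/
  mem : ∀ i ≤ L.N, L.x i ∈ Q.toValuationSubring
  /-- with residues outside `𝔽_q` -/
  valuation_eq_one : ∀ i ≤ L.N, Q.valuation (L.x i ^ q - L.x i) = 1
  /-- `Q` is unramified over `K(x₀)`: a local parameter `p(x₀)` with `p'(x₀)` a unit -/
  chart : ∃ f : K[X], Q.ord (aeval (L.x 0) f) = 1 ∧ aeval (L.x 0) (derivative f) ≠ 0 ∧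
    Q.ord (aeval (L.x 0) (derivative f)) = 0

/-- **Profile of a place above `x₀ = β`, `β ∈ 𝔽_q`**, with parameters `t` (the number of initial
generators `x₀, …, x_{t-1}` vanishing at `Q`) and `α ∈ 𝔽_q^×` (the residue of `x_t`): the orders of
all `x_i` at `Q` and the "mirror" congruences `x_i ≡ -α²/x_{2t-i}` ([GS96, Lemmas 3.3–3.5, (3.4),
(3.11)]; Stichtenoth Lemma 7.4.6). The ramification index of `Q` over `(x₀ = β)` is `q^{N-2t}`
(`= 1` if `N ≤ 2t`). [cite: Stichtenoth2009, Lemma 7.4.6] [cite: GarciaStichtenoth1996, Lemmas 3.3–3.5] -/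
structure BadProfile (Q : PlaceOver K L.carrier) (β : K) (t : ℕ) (α : K) : Prop where
  /-- `t ≤ N + 1` -/
  t_le : t ≤ L.N + 1
  /-- over `β ≠ 0` no generator vanishes and `α = β` -/
  t_eq_zero : β ≠ 0 → t = 0 ∧ α = β
  /-- over `β = 0` at least `x₀` vanishes -/
  one_le_t : β = 0 → 1 ≤ t
  /-- `α ∈ 𝔽_q` -/
  pow_eq : α ^ q = α
  /-- `α ≠ 0` -/
  ne_zero : α ≠ 0
  /-- `v(x_i) = q^{N-2t} q^i` for `i < t` -/
  ord_lt : ∀ i, i < t → i ≤ L.N → Q.ord (L.x i) = (q : ℤ) ^ (L.N - 2 * t) * (q : ℤ) ^ i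
  /-- `v(x_t - α) = q^{N-2t} q^t` -/
  ord_t : t ≤ L.N → Q.ord (L.x t - algebraMap K L.carrier α) = (q : ℤ) ^ (L.N - 2 * t) * (q : ℤ) ^ t
  /-- `v(x_i) = -q^{N-2t} q^{2t-i}` for `t < i ≤ 2t` -/
  ord_mid : ∀ i, t < i → i ≤ 2 * t → i ≤ L.N →
    Q.ord (L.x i) = -((q : ℤ) ^ (L.N - 2 * t) * (q : ℤ) ^ (2 * t - i))
  /-- the mirror congruences `x_i + α²/x_{2t-i} ∈ 𝒪_Q` for `t < i ≤ 2t` -/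
  mirror : ∀ i, t < i → i ≤ 2 * t → i ≤ L.N →
    L.x i + algebraMap K L.carrier (α ^ 2) / L.x (2 * t - i) ∈ Q.toValuationSubring
  /-- `v(x_i) = -q^{N-i}` for `2t < i` -/
  ord_gt : ∀ i, 2 * t < i → i ≤ L.N → Q.ord (L.x i) = -((q : ℤ) ^ (L.N - i))

end Level

/-! ### The bottom level `G₀ = K(x₀)` and the tower -/

/-- `v_∞(X) = -1` in `K(X)`. [cite: Stichtenoth2009, Prop. 1.2.1(c)] -/
theorem ord_ratFuncInftyPlace_X : (ratFuncInftyPlace K).ord (RatFunc.X : RatFunc K) = -1 := by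
  have hX : (RatFunc.X : RatFunc K) ≠ 0 := RatFunc.X_ne_zero
  have h1 : -1 ≤ (ratFuncInftyPlace K).ord (RatFunc.X : RatFunc K) := by
    rw [← (ratFuncInftyPlace K).valuation_le_zpow_iff_le_ord hX, show (-1 : ℤ) = -(1 : ℤ) from rfl,
      valuation_ratFuncInftyPlace_le_iff, RatFunc.inftyValuation.X]
  have h2 : ¬ (0 ≤ (ratFuncInftyPlace K).ord (RatFunc.X : RatFunc K)) := by
    rw [← (ratFuncInftyPlace K).valuation_le_zpow_iff_le_ord hX, show (0 : ℤ) = -(0 : ℤ) from rfl,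
      valuation_ratFuncInftyPlace_le_iff, RatFunc.inftyValuation.X, not_le]
    exact WithZero.exp_lt_exp.2 zero_lt_one
  omega

/-- **The bottom level `G₀ = K(x₀)`**, `x₀ = X`, `P_∞^{(0)}` the pole of `X` (reducible, like `next`).
[cite: Stichtenoth2009, Def. 7.4.1] -/
@[reducible] def base : Level K q where
  carrier := RatFunc K
  N := 0
  x _ := RatFunc.X
  rel i hi := absurd hi (Nat.not_lt_zero i)
  Pinf := ratFuncInftyPlace K
  isRational_Pinf := degree_ratFuncInftyPlace
  ord_Pinf i hi := by
    rw [Nat.le_zero.1 hi, Nat.sub_self, pow_zero, ord_ratFuncInftyPlace_X]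
  finrank_eq := by
    rw [pow_zero, show K⟮(RatFunc.X : RatFunc K)⟯ = ⊤ from RatFunc.adjoin_X, IntermediateField.finrank_top]

variable [Fact (2 ≤ q)]

/-- **The `N`-th level `G_N` of the Garcia–Stichtenoth tower over `K`.**
[cite: Stichtenoth2009, Def. 7.4.1] -/
def level : ℕ → Level K q
  | 0 => base K q
  | N + 1 => (level N).next

/-- The `N`-th level has index `N`. [folklore] -/
@[simp] theorem level_N (N : ℕ) : (level K q N).N = N := by
  induction N with
  | zero => rfl
  | succ N ih => rw [level, Level.next_N, ih]

/-- `level K q (N+1)` is the next level of `level K q N` (definitional). [folklore] -/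
theorem level_succ (N : ℕ) : level K q (N + 1) = (level K q N).next := rfl

end GSTower

end Literature.NumberTheory.DiophantineGeometry
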